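import Summits.HodgeConjecture.HodgeConjecture.Theorems.K2E1ResidueUniformMajorantCMThree   -- ★ p859103 (this seat): (R-b)₃ on the pole letter; §1 scalar, §2 the 𝓕-average, §3 `sub_two_mul_norm_le_of_pole`; brings ★ p859083 geometry, ★ :82, ★ (R-b) N = 2 §1
import HarnessLib

/-!
# K2·E1 — `K2E1ResidueUniformMajorantCMThreeLetters` ((R-b)₃, LETTERS EDITIONS): the `(σ, g)`-uniform majorant `(σ − 2)·‖E(φ₀H^σ)(g)‖ ≤ C·w₁(g)^A` of `U(2,1)_{L∕L⁺}`
# near the pole, on the SCALAR letter `(σ − 2)·‖c_ν(σ)‖ ≤ M` and on LAYER 1's constant-term letters `c r hcres hceq`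

Track B ∕ K2-LIT, crux h413 = `stmt-HodgeConjecture-24833`, route of record `HCCMUnconditional`; cell `hodgecm-mathlib`, squad K2, ENGINE E1; campaign «EIS-R7-BL-SPH-3», road (ρ2)₃.
Prover seat `hodgecm-mathlib-K2-defs1` (g6).  THEOREMS ONLY (no `def`, no `instance`, no notation, no `sorry`); lane `--supports stmt-HodgeConjecture-24833 --as helper` (count-neutral).

WHY.  ★ p859103 `residue_uniform_majorant_cm_three_of_pole` is typed on the pole letter `hpole` (local uniform boundedness of `(σ − 2)·E(H^σ)` on compacta — payer: the `N = 3` closer ∘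
MS-3).  The road consumes that letter only through the scalar bound `(σ − 2)·‖c_ν(σ)‖ ≤ M` (★ §3 `sub_two_mul_norm_le_of_pole`), and the FIRST payer in sight for that scalar is W5₃-B
(the constant-term continuation: (q10) FILE 3 ★ ∘ K2E2-p12's (U3C-c)), whose currency is LAYER 1's ★ `sphericalEisenstein_continuation_cm_three_of_layers` letters
`(c : ℂ → ℂ) (r : ℂ) (hcres : Tendsto ((z − 2)·c z) (𝓝[≠] 2) (𝓝 r)) (hceq : ∀ z, 2 < Re z → c z = (ν𝓕)⁻¹·∫ H(ι(w₀)v)^z dν)`.  This file therefore re-types the head on the scalar letter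
(§2, the core) and derives the LAYER-1-currency edition (§3) — so that whichever of W5₃-B ∕ MS-3 lands first pays (R-b)₃ BY NAME; ★ `_of_pole` = §2 ∘ ★ §3 of p859103.

* §1 `exists_pos_forall_sub_two_mul_norm_le` (`(z−2)c(z) → r` ⟹ `(σ−2)‖c(σ)‖ ≤ ‖r‖ + 1` on `(2, 2+η)`; N = 3 twin of ★ (R-b) §1), `le_mul_max_rpow_of_le_mul_ciSup_rpow` ∕ `…_siegel` (conversions).
* §2 CORE **`residue_uniform_majorant_cm_three_of_cbound (hη₁ : 0 < η₁) (hcb : ∀ σ ∈ (2, 2+η₁], (σ − 2)·‖c_ν(σ)‖ ≤ M) (φ₀) (hA : 2 < A)`** (+ `_le_max`, `_siegel`).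
* §3 **`residue_uniform_majorant_cm_three_of_letters (c r hcres hceq) (φ₀) (hA)`** — LAYER 1's letters BYTE-IDENTICAL (+ `_le_max`, `_siegel`).
HONEST LABEL: HC_CM is proved only modulo the 7 printed citations (2 remaining named inputs: hLiu418 = `stmt-HodgeConjecture-24832`, h413 = `stmt-HodgeConjecture-24833`) until rung 0
closes; this file asserts no named fact and closes no socket; every head is CONDITIONAL by construction on its displayed letter(s).
References: [MoeglinWaldspurger1995] II.1.5, II.1.7, IV.1.9, IV.1.11 · [Garrett2018] §2.8, §3.10 · [Godement1964] §8 · [Rogawski1990] §2.2.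
-/

set_option autoImplicit false
-- the mandated namespace repeats the single-problem summit's segment (`HodgeConjecture.HodgeConjecture`)
set_option linter.dupNamespace false

noncomputable section

open MeasureTheory Measure NumberField IsDedekindDomain Set Filter Module MulAction
open scoped ENNReal NNReal Topology Classical Pointwise
open Literature.NumberTheory.Automorphic Literature.NumberTheory.Automorphic.UnitaryGroup AdelicGroupData
open Summit.HodgeConjecture.HodgeConjecture.Cruxes.H413.K2E1BorelEisensteinU
open Summit.HodgeConjecture.HodgeConjecture.Cruxes.H413.K2E1SphericalEisensteinContinuationU3Final (borelConstantTerm_sphericalEisenstein_cm_three)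
open Summit.HodgeConjecture.HodgeConjecture.Cruxes.H413.K2E1BorelEisensteinGodementU (exists_smear_borelHeight borelHeight_toAdelic_mul_le_max_three)
open Summit.HodgeConjecture.HodgeConjecture.Cruxes.H413.K2E1BLHeightCosetsU3 (borelHeight_mul_le_ciSup)
open Summit.HodgeConjecture.HodgeConjecture.Cruxes.H413.K2E1BLReductionCoveringU3 (exists_pos_forall_lt_ciSup_borelHeight_mul_cm_three)
open Summit.HodgeConjecture.HodgeConjecture.Cruxes.H413.K2E1EisensteinCompactRangeMajorantCMThree (norm_eisensteinSeriesU_flatSectionU_const_ofReal_three)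
open Summit.HodgeConjecture.HodgeConjecture.Cruxes.H413.K2E1SiegelSmearSetU3 (exists_siegel_smear_cm_three)
open Summit.HodgeConjecture.HodgeConjecture.Cruxes.H413.K2E1HeightFunctionU3 (borelHeight_one)
open Summit.HodgeConjecture.HodgeConjecture.Cruxes.H413.K2E1ResidueUniformMajorantCMThree (residue_majorant_arith_three tsum_borelHeight_rpow_le_of_borelConstantTerm_three sub_two_mul_norm_le_of_pole)

namespace Summit.HodgeConjecture.HodgeConjecture.Cruxes.H413.K2E1ResidueUniformMajorantCMThreeLetters

/-! ## §1 Scalar lemma and the two conversions of the head -/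

/-- If `(z − 2)·c(z) → r` as `z → 2` (`z ≠ 2`) then `(σ − 2)·‖c(σ)‖ ≤ ‖r‖ + 1` for real `σ ∈ (2, 2 + η)`, some `η > 0` (N = 3 twin of ★ `exists_pos_forall_sub_one_mul_norm_le`).
[cite: MoeglinWaldspurger1995, IV.1.11] -/
theorem exists_pos_forall_sub_two_mul_norm_le {c : ℂ → ℂ} {r : ℂ} (hc : Tendsto (fun z : ℂ => (z - 2) * c z) (𝓝[≠] 2) (𝓝 r)) :
    ∃ η : ℝ, 0 < η ∧ ∀ σ : ℝ, 2 < σ → σ < 2 + η → (σ - 2) * ‖c σ‖ ≤ ‖r‖ + 1 := by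
  have h1 : ∀ᶠ z : ℂ in 𝓝[≠] 2, ‖(z - 2) * c z‖ < ‖r‖ + 1 := hc.norm.eventually (Iio_mem_nhds (lt_add_one ‖r‖))
  obtain ⟨ε, hε, h⟩ := Metric.eventually_nhds_iff.1 (eventually_nhdsWithin_iff.1 h1)
  refine ⟨ε, hε, fun σ hσ hσε => ?_⟩
  have hsub : (σ : ℂ) - 2 = ((σ - 2 : ℝ) : ℂ) := by push_cast; ring
  have hne : (σ : ℂ) ≠ 2 := fun h' => hσ.ne' (by exact_mod_cast h')
  have hdist : dist (σ : ℂ) 2 < ε := by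
    rw [dist_eq_norm, hsub, Complex.norm_real, Real.norm_eq_abs, abs_of_pos (sub_pos.2 hσ)]
    linarith
  have h2 : ‖((σ : ℂ) - 2) * c σ‖ < ‖r‖ + 1 := h hdist hne
  rw [norm_mul, hsub, Complex.norm_real, Real.norm_eq_abs, abs_of_pos (sub_pos.2 hσ)] at h2
  exact h2.le

variable (L : Type) [Field L] [NumberField L] [IsCMField L]

/-- **Conversion to the height form**: a bound `x ≤ C·w₁(g)^A` (`C ≥ 0`, `A ≥ 0`) gives `x ≤ C·max(H(g), H(g)⁻¹)^A` — `w₁(g) ≤ max(H g, (H g)⁻¹)` by the Siegel property ★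
`borelHeight_toAdelic_mul_le_max_three`. [cite: MoeglinWaldspurger1995, I.2.2] [cite: Garrett2018, §2.3] -/
theorem le_mul_max_rpow_of_le_mul_ciSup_rpow {C A x : ℝ} (hC : 0 ≤ C) (hA : 0 ≤ A) (g : (quasiSplit (↥(maximalRealSubfield L)) L (IsCMField.complexConj L) 3).Adelic) (h : x ≤ C * (((⨆ γ : (quasiSplit (↥(maximalRealSubfield L)) L (IsCMField.complexConj L) 3).arithmeticSubgroup, borelHeight ((γ : (quasiSplit (↥(maximalRealSubfield L)) L (IsCMField.complexConj L) 3).Adelic) * g)) : ℝ≥0) : ℝ) ^ A) :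
    x ≤ C * (max (borelHeight g : ℝ) (borelHeight g : ℝ)⁻¹) ^ A := by
  refine h.trans (mul_le_mul_of_nonneg_left ?_ hC)
  have hw : (⨆ γ : (quasiSplit (↥(maximalRealSubfield L)) L (IsCMField.complexConj L) 3).arithmeticSubgroup, borelHeight ((γ : (quasiSplit (↥(maximalRealSubfield L)) L (IsCMField.complexConj L) 3).Adelic) * g)) ≤ max (borelHeight g) (borelHeight g)⁻¹ := by
    refine ciSup_le fun γ => ?_
    obtain ⟨γ', hγ'⟩ := MonoidHom.mem_range.1 γ.2
    rw [← hγ']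
    exact borelHeight_toAdelic_mul_le_max_three γ' g
  have hw' : (((⨆ γ : (quasiSplit (↥(maximalRealSubfield L)) L (IsCMField.complexConj L) 3).arithmeticSubgroup, borelHeight ((γ : (quasiSplit (↥(maximalRealSubfield L)) L (IsCMField.complexConj L) 3).Adelic) * g)) : ℝ≥0) : ℝ) ≤ max (borelHeight g : ℝ) (borelHeight g : ℝ)⁻¹ := by exact_mod_cast hw
  exact Real.rpow_le_rpow (NNReal.coe_nonneg _) hw' hA

/-- **Conversion to the Siegel-set form**: on `{1 ≤ H}`, `max(H(g), H(g)⁻¹) = H(g)`. [cite: MoeglinWaldspurger1995, I.2.2] -/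
theorem le_mul_rpow_of_le_mul_max_rpow {C A x : ℝ} (g : (quasiSplit (↥(maximalRealSubfield L)) L (IsCMField.complexConj L) 3).Adelic) (hg : 1 ≤ borelHeight g) (h : x ≤ C * (max (borelHeight g : ℝ) (borelHeight g : ℝ)⁻¹) ^ A) :
    x ≤ C * (borelHeight g : ℝ) ^ A := by
  have hg' : (1 : ℝ) ≤ (borelHeight g : ℝ) := by exact_mod_cast hg
  rwa [max_eq_left ((inv_le_one_of_one_le₀ hg').trans hg')] at h

variable [MeasurableSpace (quasiSplit (↥(maximalRealSubfield L)) L (IsCMField.complexConj L) 3).Adelic] [BorelSpace (quasiSplit (↥(maximalRealSubfield L)) L (IsCMField.complexConj L) 3).Adelic]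

/-! ## §2 The core: the head on the scalar letter `(σ − 2)·‖c_ν(σ)‖ ≤ M` -/

/-- **THE `(σ, g)`-UNIFORM MAJORANT OF `(σ − 2)·E(φ₀H^σ)(g)` NEAR THE POLE, ON THE SCALAR LETTER** (the core of (R-b)₃): for the CM pair `(L⁺, L)`, Haar `ν` on `N(𝔸_{L⁺})`, a fundamental
domain `𝓕` of `N(L⁺)` with compact closure, `η₁ > 0`, the letter `hcb : ∀ σ ∈ (2, 2 + η₁], (σ − 2)·‖c_ν(σ)‖ ≤ M` on the scalar `c_ν(σ) = (ν𝓕)⁻¹·∫_{N(𝔸)} H(ι(w₀)v)^σ dν` of ★ :82, `φ₀ : ℂ` and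
ANY `A > 2`: `∃ η > 0, ∃ C ≥ 0, ∀ σ ∈ (2, 2 + η], ∀ g, (σ − 2)·‖E(φ₀H^σ)(g)‖ ≤ C·w₁(g)^A`.  Proof = ★ p859103's: ★ smearing set `exists_siegel_smear_cm_three`, ★ smear `exists_smear_borelHeight`,
★ the 𝓕-average `tsum_borelHeight_rpow_le_of_borelConstantTerm_three` at `y₀` with ★ :82, heights `t^{[L:ℚ]} ≤ H(y₀) ≤ A₀·w₁(g)`, `w₁ ≥ c₁` ★, bookkeeping ★ `residue_majorant_arith_three`.
[cite: MoeglinWaldspurger1995, II.1.5 and IV.1.9] [cite: Garrett2018, §2.8 and §3.10] [cite: Godement1964, §8] -/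
theorem residue_uniform_majorant_cm_three_of_cbound
    (ν : Measure ↥(adelicUnipotent (↥(maximalRealSubfield L)) L (IsCMField.complexConj L) 3)) [ν.IsHaarMeasure] {𝓕 : Set ↥(adelicUnipotent (↥(maximalRealSubfield L)) L (IsCMField.complexConj L) 3)} (h𝓕N : IsFundamentalDomain ↥(rationalUnipotent (↥(maximalRealSubfield L)) L (IsCMField.complexConj L) 3) 𝓕 ν) (h𝓕c : IsCompact (closure 𝓕))
    {η₁ M : ℝ} (hη₁ : 0 < η₁) (hcb : ∀ σ : ℝ, 2 < σ → σ ≤ 2 + η₁ → (σ - 2) * ‖(((((ν 𝓕).toReal⁻¹ : ℝ)) : ℂ) * (∫ v : ↥(adelicUnipotent (↥(maximalRealSubfield L)) L (IsCMField.complexConj L) 3), (((borelHeight (((quasiSplit (↥(maximalRealSubfield L)) L (IsCMField.complexConj L) 3).toAdelic (weylLongU ((IsCMField.complexConj L : L ≃ₐ[↥(maximalRealSubfield L)] L) : L →+* L) (rfl : (StdForm.antidiagonal 3).over L = (StdForm.antidiagonal 3).over L))) * (v : (quasiSplit (↥(maximalRealSubfield L)) L (IsCMField.complexConj L) 3).Adelic)))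 : ℝ) : ℂ) ^ ((σ : ℝ) : ℂ) ∂ν))‖ ≤ M)
    (φ₀ : ℂ) {A : ℝ} (hA : 2 < A) :
    ∃ η : ℝ, 0 < η ∧ ∃ C : ℝ, 0 ≤ C ∧ ∀ σ : ℝ, 2 < σ → σ ≤ 2 + η → ∀ g : (quasiSplit (↥(maximalRealSubfield L)) L (IsCMField.complexConj L) 3).Adelic,
      (σ - 2) * ‖eisensteinSeriesU (flatSectionU (fun _ : (quasiSplit (↥(maximalRealSubfield L)) L (IsCMField.complexConj L) 3).Adelic => φ₀) ((σ : ℝ) : ℂ)) (g)‖ ≤ C * (((⨆ γ : (quasiSplit (↥(maximalRealSubfield L)) L (IsCMField.complexConj L) 3).arithmeticSubgroup, borelHeight ((γ : (quasiSplit (↥(maximalRealSubfield L)) L (IsCMField.complexConj L) 3).Adelic) * g)) : ℝ≥0) : ℝ) ^ A := by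
  -- ★ the smearing set of the Siegel reduction (`W = 𝓕̄`), ★ the smear constant `A₀ ≥ 1`, ★ `w₁ ≥ c₁ > 0`
  obtain ⟨t, C, ht, hC, hred⟩ := exists_siegel_smear_cm_three L h𝓕c
  obtain ⟨A₀, hA₀, hsmear⟩ := exists_smear_borelHeight (exists_mem_borelAdelic_mul_mem_standardMaximalCompactGL_cm_three L) hC
  obtain ⟨c₁, hc₁, hw₁⟩ := exists_pos_forall_lt_ciSup_borelHeight_mul_cm_three L
  obtain ⟨u₀, hu₀⟩ : 𝓕.Nonempty := nonempty_of_measure_ne_zero (measure_ne_zero_of_isFundamentalDomain_rationalUnipotent ν h𝓕N)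
  -- constants: the height floor `h₀ = t^{[L:ℚ]}` (`H(1) = 1`), the window `η`, the constant
  obtain ⟨h₀, hh₀def⟩ : ∃ h₀ : ℝ, h₀ = t ^ Module.finrank ℚ L := ⟨_, rfl⟩
  have hh₀ : 0 < h₀ := by rw [hh₀def]; exact pow_pos ht _
  obtain ⟨η, hηdef⟩ : ∃ η : ℝ, η = min η₁ (A - 2) := ⟨_, rfl⟩
  have hη : 0 < η := by rw [hηdef]; exact lt_min hη₁ (sub_pos.2 hA)
  have hηη₁ : η ≤ η₁ := by rw [hηdef]; exact min_le_left _ _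
  have hηA : 2 + η ≤ A := by have h := min_le_right η₁ (A - 2); rw [← hηdef] at h; linarith
  have hA₀' : (1 : ℝ) ≤ (A₀ : ℝ) := by exact_mod_cast hA₀
  have hc₁' : (0 : ℝ) < (c₁ : ℝ) := by exact_mod_cast hc₁
  have hM0 : 0 ≤ M := by
    have h := hcb (2 + η₁) (by linarith) le_rfl
    exact le_trans (mul_nonneg (by linarith) (norm_nonneg _)) h
  have hK0 : 0 ≤ (A₀ : ℝ) ^ A * (η * (1 + ((A₀ : ℝ) * (c₁ : ℝ))⁻¹ ^ A) * (A₀ : ℝ) ^ A + M * (1 + h₀⁻¹ ^ η) * (c₁ : ℝ)⁻¹ ^ A) := by positivity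
  refine ⟨η, hη, ‖φ₀‖ * ((A₀ : ℝ) ^ A * (η * (1 + ((A₀ : ℝ) * (c₁ : ℝ))⁻¹ ^ A) * (A₀ : ℝ) ^ A + M * (1 + h₀⁻¹ ^ η) * (c₁ : ℝ)⁻¹ ^ A)),
    mul_nonneg (norm_nonneg _) hK0, fun σ hσ hση g => ?_⟩
  have hz : (2 : ℝ) < (((σ : ℝ) : ℂ)).re := by rwa [Complex.ofReal_re]
  -- reduce `g`: `γ g = u · y₀ · c′` for every `u ∈ 𝓕̄`, `H(y₀) = r^{[L:ℚ]}`, `r ≥ t`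
  obtain ⟨γ, y₀, r, htr, hHy₀, hfac⟩ := hred g
  obtain ⟨γ', hγ'⟩ := MonoidHom.mem_range.1 γ.2
  -- automorphy: `E(φ₀H^σ)(g) = E(φ₀H^σ)(γ g)`
  have haut : eisensteinSeriesU (flatSectionU (fun _ : (quasiSplit (↥(maximalRealSubfield L)) L (IsCMField.complexConj L) 3).Adelic => φ₀) ((σ : ℝ) : ℂ)) (g) = eisensteinSeriesU (flatSectionU (fun _ : (quasiSplit (↥(maximalRealSubfield L)) L (IsCMField.complexConj L) 3).Adelic => φ₀) ((σ : ℝ) : ℂ)) ((γ : (quasiSplit (↥(maximalRealSubfield L)) L (IsCMField.complexConj L) 3).Adelic) * g) := by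
    rw [← hγ']
    exact (eisensteinSeriesU_flatSectionU_rational_mul (φ := fun _ : (quasiSplit (↥(maximalRealSubfield L)) L (IsCMField.complexConj L) 3).Adelic => φ₀) (fun _ _ _ => rfl) ((σ : ℝ) : ℂ) γ' g).symm
  -- the smear: `H(x·γg) ≤ A₀·H(x·u y₀)` for every `u ∈ 𝓕 ⊆ 𝓕̄` and every `x`
  have hsm : ∀ u ∈ 𝓕, ∀ x : (quasiSplit (↥(maximalRealSubfield L)) L (IsCMField.complexConj L) 3).Adelic, borelHeight (x * ((γ : (quasiSplit (↥(maximalRealSubfield L)) L (IsCMField.complexConj L) 3).Adelic) * g)) ≤ A₀ * borelHeight (x * ((u : (quasiSplit (↥(maximalRealSubfield L)) L (IsCMField.complexConj L) 3).Adelic) * y₀)) := by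
    intro u hu x
    obtain ⟨c', hc', hfac'⟩ := hfac u (subset_closure hu)
    rw [hfac', ← mul_assoc x]
    exact (hsmear _ c' hc').1
  -- the constant term of `E(H^σ)` at `y₀` (★ :82, `φ₀ = 1`)
  obtain ⟨cν, hcν⟩ : ∃ cν : ℂ, cν = (((((ν 𝓕).toReal⁻¹ : ℝ)) : ℂ) * (∫ v : ↥(adelicUnipotent (↥(maximalRealSubfield L)) L (IsCMField.complexConj L) 3), (((borelHeight (((quasiSplit (↥(maximalRealSubfield L)) L (IsCMField.complexConj L) 3).toAdelic (weylLongU ((IsCMField.complexConj L : L ≃ₐ[↥(maximalRealSubfield L)] L) : L →+* L) (rfl : (StdForm.antidiagonal 3).over L = (StdForm.antidiagonal 3).over L))) * (v : (quasiSplit (↥(maximalRealSubfield L)) L (IsCMField.complexConj L) 3).Adelic))) : ℝ) : ℂ) ^ ((σ : ℝ) : ℂ) ∂ν)) := ⟨_, rfl⟩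
  have hCT : borelConstantTerm ν 𝓕 (eisensteinSeriesU (flatSectionU (fun _ : (quasiSplit (↥(maximalRealSubfield L)) L (IsCMField.complexConj L) 3).Adelic => (1 : ℂ)) ((σ : ℝ) : ℂ))) y₀ =
      1 * ((((borelHeight y₀ : ℝ)) : ℂ) ^ ((σ : ℝ) : ℂ) + cν * (((borelHeight y₀ : ℝ)) : ℂ) ^ (2 - ((σ : ℝ) : ℂ))) := by
    rw [borelConstantTerm_sphericalEisenstein_cm_three L ν h𝓕N h𝓕c 1 hz y₀, hcν]
  -- ★ §2's average: `Σ_q H(γ̃_q γg)^σ ≤ A₀^σ (H(y₀)^σ + ‖c_ν(σ)‖ H(y₀)^{2−σ})`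
  have hS := tsum_borelHeight_rpow_le_of_borelConstantTerm_three L ν h𝓕N h𝓕c hσ hCT hsm
  -- heights: `h₀ ≤ H(y₀) ≤ A₀·H(γ g) ≤ A₀·w₁(g)`, `c₁ ≤ w₁(g)`
  have hHt : h₀ ≤ (borelHeight y₀ : ℝ) := by
    have h1 : (borelHeight y₀ : ℝ) = ((r : ℝ≥0) : ℝ) ^ Module.finrank ℚ L := by
      rw [hHy₀, borelHeight_one, mul_one, NNReal.coe_pow]
    rw [hh₀def, h1]
    exact pow_le_pow_left₀ ht.le htr _
  have hHw : (borelHeight y₀ : ℝ) ≤ (A₀ : ℝ) * (((⨆ γ : (quasiSplit (↥(maximalRealSubfield L)) L (IsCMField.complexConj L) 3).arithmeticSubgroup, borelHeight ((γ : (quasiSplit (↥(maximalRealSubfield L)) L (IsCMField.complexConj L) 3).Adelic) * g)) : ℝ≥0) : ℝ) := by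
    obtain ⟨c', hc', hfac'⟩ := hfac u₀ (subset_closure hu₀)
    have h1 : borelHeight y₀ = borelHeight ((u₀ : (quasiSplit (↥(maximalRealSubfield L)) L (IsCMField.complexConj L) 3).Adelic) * y₀) := (borelHeight_unipotent_mul u₀.2 y₀).symm
    have h2 : borelHeight ((u₀ : (quasiSplit (↥(maximalRealSubfield L)) L (IsCMField.complexConj L) 3).Adelic) * y₀) ≤ A₀ * borelHeight ((u₀ : (quasiSplit (↥(maximalRealSubfield L)) L (IsCMField.complexConj L) 3).Adelic) * y₀ * c') := (hsmear _ c' hc').2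
    have h3 : borelHeight ((u₀ : (quasiSplit (↥(maximalRealSubfield L)) L (IsCMField.complexConj L) 3).Adelic) * y₀ * c') ≤ (⨆ γ : (quasiSplit (↥(maximalRealSubfield L)) L (IsCMField.complexConj L) 3).arithmeticSubgroup, borelHeight ((γ : (quasiSplit (↥(maximalRealSubfield L)) L (IsCMField.complexConj L) 3).Adelic) * g)) := by
      rw [← hfac']
      exact borelHeight_mul_le_ciSup γ g
    exact_mod_cast (h1.le.trans h2).trans (mul_le_mul_of_nonneg_left h3 (by positivity))
  have hw : (c₁ : ℝ) ≤ (((⨆ γ : (quasiSplit (↥(maximalRealSubfield L)) L (IsCMField.complexConj L) 3).arithmeticSubgroup, borelHeight ((γ : (quasiSplit (↥(maximalRealSubfield L)) L (IsCMField.complexConj L) 3).Adelic) * g)) : ℝ≥0) : ℝ) := by exact_mod_cast (hw₁ g).le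
  -- the scalar letter at `σ ≤ 2 + η ≤ 2 + η₁`
  have hMσ : (σ - 2) * ‖cν‖ ≤ M := by
    rw [hcν]
    exact hcb σ hσ (hση.trans (by linarith))
  -- bookkeeping
  have key := residue_majorant_arith_three hσ hση hηA hA₀' hh₀ hHt hHw hc₁' hw (norm_nonneg cν) hMσ hS
  rw [haut, norm_eisensteinSeriesU_flatSectionU_const_ofReal_three, mul_left_comm, mul_assoc ‖φ₀‖]
  exact mul_le_mul_of_nonneg_left key (norm_nonneg _)

/-- **CORE, HEIGHT FORM** (all `g`): `(σ − 2)·‖E(φ₀H^σ)(g)‖ ≤ C·max(H(g), H(g)⁻¹)^A` on the scalar letter. [cite: MoeglinWaldspurger1995, I.2.2 and II.1.5] -/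
theorem residue_uniform_majorant_cm_three_of_cbound_le_max
    (ν : Measure ↥(adelicUnipotent (↥(maximalRealSubfield L)) L (IsCMField.complexConj L) 3)) [ν.IsHaarMeasure] {𝓕 : Set ↥(adelicUnipotent (↥(maximalRealSubfield L)) L (IsCMField.complexConj L) 3)} (h𝓕N : IsFundamentalDomain ↥(rationalUnipotent (↥(maximalRealSubfield L)) L (IsCMField.complexConj L) 3) 𝓕 ν) (h𝓕c : IsCompact (closure 𝓕))
    {η₁ M : ℝ} (hη₁ : 0 < η₁) (hcb : ∀ σ : ℝ, 2 < σ → σ ≤ 2 + η₁ → (σ - 2) * ‖(((((ν 𝓕).toReal⁻¹ : ℝ)) : ℂ) * (∫ v : ↥(adelicUnipotent (↥(maximalRealSubfield L)) L (IsCMField.complexConj L) 3), (((borelHeight (((quasiSplit (↥(maximalRealSubfield L)) L (IsCMField.complexConj L) 3).toAdelic (weylLongU ((IsCMField.complexConj L : L ≃ₐ[↥(maximalRealSubfield L)] L) : L →+* L) (rfl : (StdForm.antidiagonal 3).over L = (StdForm.antidiagonal 3).over L))) * (v : (quasiSplit (↥(maximalRealSubfield L)) L (IsCMField.complexConj L)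 3).Adelic))) : ℝ) : ℂ) ^ ((σ : ℝ) : ℂ) ∂ν))‖ ≤ M)
    (φ₀ : ℂ) {A : ℝ} (hA : 2 < A) :
    ∃ η : ℝ, 0 < η ∧ ∃ C : ℝ, 0 ≤ C ∧ ∀ σ : ℝ, 2 < σ → σ ≤ 2 + η → ∀ g : (quasiSplit (↥(maximalRealSubfield L)) L (IsCMField.complexConj L) 3).Adelic,
      (σ - 2) * ‖eisensteinSeriesU (flatSectionU (fun _ : (quasiSplit (↥(maximalRealSubfield L)) L (IsCMField.complexConj L) 3).Adelic => φ₀) ((σ : ℝ) : ℂ)) (g)‖ ≤ C * (max (borelHeight g : ℝ) (borelHeight g : ℝ)⁻¹) ^ A := by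
  obtain ⟨η, hη, C, hC, h⟩ := residue_uniform_majorant_cm_three_of_cbound L ν h𝓕N h𝓕c hη₁ hcb φ₀ hA
  exact ⟨η, hη, C, hC, fun σ hσ hση g => le_mul_max_rpow_of_le_mul_ciSup_rpow L hC (by linarith) g (h σ hσ hση g)⟩

/-- **CORE, SIEGEL-SET FORM**: `(σ − 2)·‖E(φ₀H^σ)(g)‖ ≤ C·H(g)^A` on `{1 ≤ H}`, on the scalar letter. [cite: MoeglinWaldspurger1995, I.2.2 and II.1.5] [cite: Garrett2018, §2.8] -/
theorem residue_uniform_majorant_cm_three_of_cbound_siegel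
    (ν : Measure ↥(adelicUnipotent (↥(maximalRealSubfield L)) L (IsCMField.complexConj L) 3)) [ν.IsHaarMeasure] {𝓕 : Set ↥(adelicUnipotent (↥(maximalRealSubfield L)) L (IsCMField.complexConj L) 3)} (h𝓕N : IsFundamentalDomain ↥(rationalUnipotent (↥(maximalRealSubfield L)) L (IsCMField.complexConj L) 3) 𝓕 ν) (h𝓕c : IsCompact (closure 𝓕))
    {η₁ M : ℝ} (hη₁ : 0 < η₁) (hcb : ∀ σ : ℝ, 2 < σ → σ ≤ 2 + η₁ → (σ - 2) * ‖(((((ν 𝓕).toReal⁻¹ : ℝ)) : ℂ) * (∫ v : ↥(adelicUnipotent (↥(maximalRealSubfield L)) L (IsCMField.complexConj L) 3), (((borelHeight (((quasiSplit (↥(maximalRealSubfield L)) L (IsCMField.complexConj L) 3).toAdelic (weylLongU ((IsCMField.complexConj L : L ≃ₐ[↥(maximalRealSubfield L)] L) : L →+* L) (rfl : (StdForm.antidiagonal 3).over L = (StdForm.antidiagonal 3).over L))) * (v : (quasiSplit (↥(maximalRealSubfield L)) L (IsCMField.complexConj L) 3).Adelic))) : ℝ) : ℂ) ^ ((σ :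 ℝ) : ℂ) ∂ν))‖ ≤ M)
    (φ₀ : ℂ) {A : ℝ} (hA : 2 < A) :
    ∃ η : ℝ, 0 < η ∧ ∃ C : ℝ, 0 ≤ C ∧ ∀ σ : ℝ, 2 < σ → σ ≤ 2 + η → ∀ g : (quasiSplit (↥(maximalRealSubfield L)) L (IsCMField.complexConj L) 3).Adelic, 1 ≤ borelHeight g →
      (σ - 2) * ‖eisensteinSeriesU (flatSectionU (fun _ : (quasiSplit (↥(maximalRealSubfield L)) L (IsCMField.complexConj L) 3).Adelic => φ₀) ((σ : ℝ) : ℂ)) (g)‖ ≤ C * (borelHeight g : ℝ) ^ A := by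
  obtain ⟨η, hη, C, hC, h⟩ := residue_uniform_majorant_cm_three_of_cbound_le_max L ν h𝓕N h𝓕c hη₁ hcb φ₀ hA
  exact ⟨η, hη, C, hC, fun σ hσ hση g hg => le_mul_rpow_of_le_mul_max_rpow L g hg (h σ hσ hση g)⟩

/-! ## §3 The LAYER 1 currency: the head on the constant-term continuation letters `c r hcres hceq` -/

/-- **THE `(σ, g)`-UNIFORM MAJORANT NEAR THE POLE, ON LAYER 1's CONSTANT-TERM LETTERS** (the `N = 3` twin of ★ `residue_uniform_majorant_cm_two` in the currency W5₃-B pays): for the CM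
pair, `ν`, `𝓕` as above, a constant-term continuation `c` with `(z − 2)·c(z) → r` at `2` (`hcres`) agreeing with the scalar of ★ :82 on `Re z > 2` (`hceq`, LAYER 1 ★
`sphericalEisenstein_continuation_cm_three_of_layers`'s bytes), `φ₀ : ℂ` and ANY `A > 2`: `∃ η > 0, ∃ C ≥ 0, ∀ σ ∈ (2, 2 + η], ∀ g, (σ − 2)·‖E(φ₀H^σ)(g)‖ ≤ C·w₁(g)^A` — §1
`exists_pos_forall_sub_two_mul_norm_le` turns `hcres` into the scalar letter on `(2, 2 + η₁∕2]`, then §2. [cite: MoeglinWaldspurger1995, II.1.5, IV.1.9 and IV.1.11] [cite: Garrett2018, §2.8] -/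
theorem residue_uniform_majorant_cm_three_of_letters
    (ν : Measure ↥(adelicUnipotent (↥(maximalRealSubfield L)) L (IsCMField.complexConj L) 3)) [ν.IsHaarMeasure] {𝓕 : Set ↥(adelicUnipotent (↥(maximalRealSubfield L)) L (IsCMField.complexConj L) 3)} (h𝓕N : IsFundamentalDomain ↥(rationalUnipotent (↥(maximalRealSubfield L)) L (IsCMField.complexConj L) 3) 𝓕 ν) (h𝓕c : IsCompact (closure 𝓕))
    (c : ℂ → ℂ) (r : ℂ) (hcres : Tendsto (fun z : ℂ => (z - 2) * c z) (𝓝[≠] 2) (𝓝 r))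
    (hceq : ∀ z : ℂ, 2 < z.re → c z = ((((ν 𝓕).toReal⁻¹ : ℝ)) : ℂ) * ∫ v : ↥(adelicUnipotent (↥(maximalRealSubfield L)) L (IsCMField.complexConj L) 3), (((borelHeight (((quasiSplit (↥(maximalRealSubfield L)) L (IsCMField.complexConj L) 3).toAdelic (weylLongU ((IsCMField.complexConj L : L ≃ₐ[↥(maximalRealSubfield L)] L) : L →+* L) (rfl : (StdForm.antidiagonal 3).over L = (StdForm.antidiagonal 3).over L))) * (v : (quasiSplit (↥(maximalRealSubfield L)) L (IsCMField.complexConj L) 3).Adelic))) : ℝ) : ℂ) ^ z ∂ν)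
    (φ₀ : ℂ) {A : ℝ} (hA : 2 < A) :
    ∃ η : ℝ, 0 < η ∧ ∃ C : ℝ, 0 ≤ C ∧ ∀ σ : ℝ, 2 < σ → σ ≤ 2 + η → ∀ g : (quasiSplit (↥(maximalRealSubfield L)) L (IsCMField.complexConj L) 3).Adelic,
      (σ - 2) * ‖eisensteinSeriesU (flatSectionU (fun _ : (quasiSplit (↥(maximalRealSubfield L)) L (IsCMField.complexConj L) 3).Adelic => φ₀) ((σ : ℝ) : ℂ)) (g)‖ ≤ C * (((⨆ γ : (quasiSplit (↥(maximalRealSubfield L)) L (IsCMField.complexConj L) 3).arithmeticSubgroup, borelHeight ((γ : (quasiSplit (↥(maximalRealSubfield L)) L (IsCMField.complexConj L) 3).Adelic) * g)) : ℝ≥0) : ℝ) ^ A := by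
  obtain ⟨η₁, hη₁, hM⟩ := exists_pos_forall_sub_two_mul_norm_le hcres
  refine residue_uniform_majorant_cm_three_of_cbound L ν h𝓕N h𝓕c (half_pos hη₁) (M := ‖r‖ + 1) (fun σ hσ hση => ?_) φ₀ hA
  have hz : (2 : ℝ) < (((σ : ℝ) : ℂ)).re := by rwa [Complex.ofReal_re]
  rw [← hceq _ hz]
  exact hM σ hσ (by linarith)

/-- **LAYER 1 CURRENCY, HEIGHT FORM** (all `g`): `≤ C·max(H(g), H(g)⁻¹)^A`. [cite: MoeglinWaldspurger1995, I.2.2 and II.1.5] -/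
theorem residue_uniform_majorant_cm_three_of_letters_le_max
    (ν : Measure ↥(adelicUnipotent (↥(maximalRealSubfield L)) L (IsCMField.complexConj L) 3)) [ν.IsHaarMeasure] {𝓕 : Set ↥(adelicUnipotent (↥(maximalRealSubfield L)) L (IsCMField.complexConj L) 3)} (h𝓕N : IsFundamentalDomain ↥(rationalUnipotent (↥(maximalRealSubfield L)) L (IsCMField.complexConj L) 3) 𝓕 ν) (h𝓕c : IsCompact (closure 𝓕))
    (c : ℂ → ℂ) (r : ℂ) (hcres : Tendsto (fun z : ℂ => (z - 2) * c z) (𝓝[≠] 2) (𝓝 r))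
    (hceq : ∀ z : ℂ, 2 < z.re → c z = ((((ν 𝓕).toReal⁻¹ : ℝ)) : ℂ) * ∫ v : ↥(adelicUnipotent (↥(maximalRealSubfield L)) L (IsCMField.complexConj L) 3), (((borelHeight (((quasiSplit (↥(maximalRealSubfield L)) L (IsCMField.complexConj L) 3).toAdelic (weylLongU ((IsCMField.complexConj L : L ≃ₐ[↥(maximalRealSubfield L)] L) : L →+* L) (rfl : (StdForm.antidiagonal 3).over L = (StdForm.antidiagonal 3).over L))) * (v : (quasiSplit (↥(maximalRealSubfield L)) L (IsCMField.complexConj L) 3).Adelic))) : ℝ) : ℂ) ^ z ∂ν)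
    (φ₀ : ℂ) {A : ℝ} (hA : 2 < A) :
    ∃ η : ℝ, 0 < η ∧ ∃ C : ℝ, 0 ≤ C ∧ ∀ σ : ℝ, 2 < σ → σ ≤ 2 + η → ∀ g : (quasiSplit (↥(maximalRealSubfield L)) L (IsCMField.complexConj L) 3).Adelic,
      (σ - 2) * ‖eisensteinSeriesU (flatSectionU (fun _ : (quasiSplit (↥(maximalRealSubfield L)) L (IsCMField.complexConj L) 3).Adelic => φ₀) ((σ : ℝ) : ℂ)) (g)‖ ≤ C * (max (borelHeight g : ℝ) (borelHeight g : ℝ)⁻¹) ^ A := by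
  obtain ⟨η, hη, C, hC, h⟩ := residue_uniform_majorant_cm_three_of_letters L ν h𝓕N h𝓕c c r hcres hceq φ₀ hA
  exact ⟨η, hη, C, hC, fun σ hσ hση g => le_mul_max_rpow_of_le_mul_ciSup_rpow L hC (by linarith) g (h σ hσ hση g)⟩

/-- **LAYER 1 CURRENCY, SIEGEL-SET FORM**: `≤ C·H(g)^A` on `{1 ≤ H}` ((R-c)₃'s `hmaj` shape). [cite: MoeglinWaldspurger1995, I.2.2 and II.1.5] [cite: Garrett2018, §2.8] -/
theorem residue_uniform_majorant_cm_three_of_letters_siegel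
    (ν : Measure ↥(adelicUnipotent (↥(maximalRealSubfield L)) L (IsCMField.complexConj L) 3)) [ν.IsHaarMeasure] {𝓕 : Set ↥(adelicUnipotent (↥(maximalRealSubfield L)) L (IsCMField.complexConj L) 3)} (h𝓕N : IsFundamentalDomain ↥(rationalUnipotent (↥(maximalRealSubfield L)) L (IsCMField.complexConj L) 3) 𝓕 ν) (h𝓕c : IsCompact (closure 𝓕))
    (c : ℂ → ℂ) (r : ℂ) (hcres : Tendsto (fun z : ℂ => (z - 2) * c z) (𝓝[≠] 2) (𝓝 r))
    (hceq : ∀ z : ℂ, 2 < z.re → c z = ((((ν 𝓕).toReal⁻¹ : ℝ)) : ℂ) * ∫ v : ↥(adelicUnipotent (↥(maximalRealSubfield L)) L (IsCMField.complexConj L) 3), (((borelHeight (((quasiSplit (↥(maximalRealSubfield L)) L (IsCMField.complexConj L) 3).toAdelic (weylLongU ((IsCMField.complexConj L : L ≃ₐ[↥(maximalRealSubfield L)] L) : L →+* L) (rfl : (StdForm.antidiagonal 3).over L = (StdForm.antidiagonal 3).over L))) * (v : (quasiSplit (↥(maximalRealSubfield L)) L (IsCMField.complexConj L) 3).Adelic)))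 : ℝ) : ℂ) ^ z ∂ν)
    (φ₀ : ℂ) {A : ℝ} (hA : 2 < A) :
    ∃ η : ℝ, 0 < η ∧ ∃ C : ℝ, 0 ≤ C ∧ ∀ σ : ℝ, 2 < σ → σ ≤ 2 + η → ∀ g : (quasiSplit (↥(maximalRealSubfield L)) L (IsCMField.complexConj L) 3).Adelic, 1 ≤ borelHeight g →
      (σ - 2) * ‖eisensteinSeriesU (flatSectionU (fun _ : (quasiSplit (↥(maximalRealSubfield L)) L (IsCMField.complexConj L) 3).Adelic => φ₀) ((σ : ℝ) : ℂ)) (g)‖ ≤ C * (borelHeight g : ℝ) ^ A := by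
  obtain ⟨η, hη, C, hC, h⟩ := residue_uniform_majorant_cm_three_of_letters_le_max L ν h𝓕N h𝓕c c r hcres hceq φ₀ hA
  exact ⟨η, hη, C, hC, fun σ hσ hση g hg => le_mul_rpow_of_le_mul_max_rpow L g hg (h σ hσ hση g)⟩

end Summit.HodgeConjecture.HodgeConjecture.Cruxes.H413.K2E1ResidueUniformMajorantCMThreeLetters

end
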